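import Summits.Ventures.HodgeRepro.Night4ReducedDimQuadRoute
import Summits.Ventures.HodgeRepro.Night4ReducedDimQuadC10
import Summits.Ventures.HodgeRepro.Night4ReducedDimEightRoute

/-!
# Beyond the census faces, degree by degree: degree 12 is the first degree with objects smaller than its census faces

Blind re-derivation cell `pub-hodge-repro`, seat `night-4` (ROUTE HARDENING for the Monday FINAL, gen 6).  Target tree
path `lean/Summits/Ventures/HodgeRepro/Night4ReducedDimQuadDegrees.lean`.

The complete quadruple tables of gens 1–6 read across the degrees `6`, `8`, `10`, `12` of the Galois CM field (degree 14,
`Night4ReducedDimQuadC14`: `{14, 15, 21, 22, 28}`, nothing below its census minimum either — stated there)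
(`dim B_red` of every conjugate-free `SumTwo` quadruple of CM types — ROUTE.md §3.1's exceptional `(2,2)`-classes):

| degree | census faces (ROUTE.md §3.2–§3.4, gens 1–5) | all conjugate-free `SumTwo` quadruples (this series) |
|---|---|---|
| 6 | `{4}` | `{4}` — every quadruple is a face (typer's `isFace_of_sumTwo_of_card_le_eight'`) |
| 8 | `{6, 7, 8}` | `{6, 7, 8}` — every quadruple is a face |
| 10 | `{10, 11, 15}` | `{10, 11, 15, 16}` — nothing below the census minimum |
| 12 | `≥ 9` (`{9, 10, 12, 13, 14, 15, 18, 20, 21, 24}`) | `{4, 7, 8, 9, …, 24}` — FOURFOLDS, sevenfolds, eightfolds below it |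
| 14 | `{14, 15, 21, 28}` | `{14, 15, 21, 22, 28}` — nothing below the census minimum (`…QuadC14`) |

`beyond_census_degrees` states the first four rows in one theorem: degree 12 is the first (and, among the degrees computed, the
only) degree in which the census faces are NOT the smallest exceptional `(2,2)`-classes — because `C6 × C2` and `D6`
(and `C12`, `Dic3` for the eightfolds) have CM subfields of degree 4 and 6 from which corners lift (`simpleDim ∈ {1, 2, 3}`),
whereas a cyclic CM field of degree `10` or `14` has only its imaginary quadratic subfield.  Nothing here says anything
about the status of the Hodge conjecture for CM abelian varieties, which is NOT proved.
-/

set_option autoImplicit false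

namespace HodgeRepro

/-- **The smallest objects beyond the census, degree by degree** — degree 6: every conjugate-free `SumTwo` quadruple of
any `(G, c)` of order 6 has `dim B_red = 4`; degree 8 (classified): `∈ {6, 7, 8}`; degree 10 (`C10`): `≥ 10`, the census
minimum; degree 12 (classified): `≥ 4`, with `4` attained (on `C6 × C2`) — BELOW the census minimum 9. -/
theorem beyond_census_degrees :
    (∀ {G : Type} [Group G] [Fintype G] [DecidableEq G] {c : G}, Fintype.card G = 6 → IsComplexConj c →
      ∀ T : Fin 4 → Finset G, (∀ i, IsCMType c (T i)) → SumTwo T → ConjFree c T → redDim T = 4) ∧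
    (∀ {G : Type} [Group G] [Fintype G] [DecidableEq G] {c : G}, Order8Classified c → IsComplexConj c →
      ∀ T : Fin 4 → Finset G, (∀ i, IsCMType c (T i)) → SumTwo T → ConjFree c T →
        redDim T = 6 ∨ redDim T = 7 ∨ redDim T = 8) ∧
    (∀ T : Fin 4 → Finset (Multiplicative (ZMod 10)), (∀ i, IsCMType (Multiplicative.ofAdd 5) (T i)) → SumTwo T →
      ConjFree (Multiplicative.ofAdd 5) T → 10 ≤ redDim T) ∧
    (∀ {G : Type} [Group G] [Fintype G] [DecidableEq G] {c : G}, Order12Classified c →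
      ∀ T : Fin 4 → Finset G, (∀ i, IsCMType c (T i)) → SumTwo T → ConjFree c T → 4 ≤ redDim T) ∧
    (∃ T : Fin 4 → Finset C6xC2, (∀ i, IsCMType cc_C6xC2 (T i)) ∧ SumTwo T ∧ ConjFree cc_C6xC2 T ∧ redDim T = 4) :=
  ⟨fun h6 hc _ hT hsum hconj => redDim_eq_four_of_sumTwo_six h6 hc hT hsum hconj,
    fun hcl hc _ hT hsum hconj => redDim_of_sumTwo_of_order8 hcl hc hT hsum hconj,
    ten_le_redDim_sumTwo_C10,
    fun hcl T hT hsum hconj => four_le_redDim_sumTwo_of_order12 hcl T hT hsum hconj,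
    ⟨night4Quad_C6xC2_four, night4Quad_C6xC2_four_isCMType, night4Quad_C6xC2_four_sumTwo, night4Quad_C6xC2_four_conjFree,
      night4Quad_C6xC2_four_redDim⟩⟩

/-- **Degree 10 adds nothing below its census minimum**: the complete value set `{10, 11, 15, 16}` with one value beyond
the census table (`16` = `E × A₅ × A₅′ × A₅″`, four corners in three classes plus a lift), attained. -/
theorem beyond_census_ten :
    (∀ T : Fin 4 → Finset (Multiplicative (ZMod 10)), (∀ i, IsCMType (Multiplicative.ofAdd 5) (T i)) → SumTwo T →
      ConjFree (Multiplicative.ofAdd 5) T → redDim T ∈ [10, 11, 15, 16]) ∧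
    (∃ T : Fin 4 → Finset (Multiplicative (ZMod 10)), (∀ i, IsCMType (Multiplicative.ofAdd 5) (T i)) ∧ SumTwo T ∧
      ConjFree (Multiplicative.ofAdd 5) T ∧ redDim T = 16) :=
  ⟨redDim_sumTwo_C10, night4QuadAttained_C10_16⟩

end HodgeRepro
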